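import Summits.Ventures.Crystal3D.Theorems.StickyWulffConstantCoaxialWallLawSlotTriangle
import Summits.Ventures.Crystal3D.Theorems.StickyWulffConstantCoaxialWallLawModelNormals
import Summits.Ventures.Crystal3D.Theorems.StickyWulffConstantCoaxialWallLawSkewArithmetic
import Summits.Ventures.Crystal3D.Theorems.StickyWulffConstantGenericWallFloorSlotFrameIdentity
import Summits.Ventures.Crystal3D.Theorems.StickyWulffConstantGenericWallFloorTwinFrame
import Summits.Ventures.Crystal3D.Theorems.StickyWulffConstantGenericWallFloorCommonSlots
import HarnessLib

/-!
# Readings in a TWO-LATTICE configuration: which frames can read FULL or TWIN dozens on `Λ₁ ∪ Λ₂`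
# (crux `CoaxialWallLaw`, stmt-Ventures-19481, line `WallLedgerF`; interpretation completeness, part 1)

HONEST FRAMING. Venture `Summits/Ventures/Crystal3D` (cell `crystal3d-full`), helper `--supports` the crux
`CoaxialWallLaw` of `route-Ventures-StickyWulffConstant` (REGISTERED line `WallLedgerF`).  Rung credit; F-C1 not
moved; no census, no kissing facts.  cf-p1 g28 §86(79)/(86) item (3) for 19481-p2 g7 («type the completeness lemma
"a TWIN(m) reading at a site of a Λ₁ ∪ Λ₂ pattern forces m = ±K"»): the geometric half.  The census universe of the
F STEP-3 certificate (lit g15 / cf-p2 g18) is ON-SITE: `X ⊆ Λ₁ ∪ Λ₂` for the two plate lattices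
`Λᵢ = Lᵢ·Λ₀ + sᵢ`; the certificate enumerates word classes only to crossing depth 2, while the typed row
(`LocalEndRow`, `…EndRowDefs`) quantifies over ALL admissible classes.  This file pins down which frames `G` can carry
a reading at all on such an `X` (pure lattice geometry, any two frames `L₁, L₂`, any offsets):

* `mem_movedFcc_iff`, `movedFcc_add_mem_iff`, `movedFcc_sub_symm_mem` — membership algebra of `L·Λ₀ + s`;
* `mem_fcc_of_two_smul_mem` — a unit vector whose double is a lattice vector is a lattice vector (slot);
* `not_mem_fcc_of_norm_sq_eq` — a vector of squared norm `8/3` or `11/3` is not a lattice vector;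
* `image_fccSlots_eq_of_face_mem` — a frame three of whose face slots lie in `L·Λ₀` has `L`'s slot dozen;
* **`full_reading_twoLattice`** — a FULL dozen `q + G·(slots) ⊆ X ⊆ Λ₁ ∪ Λ₂` (`q ∈ X`) forces
  `G·slots = L₁·slots` or `G·slots = L₂·slots`;
The TWIN-dozen analogue is `twin_reading_twoLattice` (`…TwoLatticeTwinReading`); `…TwoLatticeClasses` specialises both
to the twin and translation plate systems of the census rows.
WHAT THIS IS NOT: not the row, not the certificate; F-C1 not moved.
-/

noncomputable section

namespace Summit.Ventures.Crystal3D.Theorems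

open Summit.Ventures.Crystal3D Finset
open Literature.MathematicalPhysics.StatisticalMechanics (fccStacking)
open scoped InnerProductSpace

/-! ### Membership algebra of a moved lattice `L·Λ₀ + s` -/

/-- `y ∈ L·Λ₀ + s ↔ L⁻¹(y − s) ∈ Λ₀`. -/
theorem mem_movedFcc_iff (L : EuclideanSpace ℝ (Fin 3) ≃ₗᵢ[ℝ] EuclideanSpace ℝ (Fin 3)) (s y : EuclideanSpace ℝ (Fin 3)) :
    y ∈ (fun p => L p + s) '' fccStacking 1 (Real.sqrt (2 / 3)) ↔ L.symm (y - s) ∈ fccStacking 1 (Real.sqrt (2 / 3)) := by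
  constructor
  · rintro ⟨x, hx, rfl⟩
    simpa using hx
  · intro h
    exact ⟨L.symm (y - s), h, by simp⟩

/-- Adding a vector to a point of `L·Λ₀ + s` stays in it iff the vector is an `L`-lattice vector. -/
theorem movedFcc_add_mem_iff (L : EuclideanSpace ℝ (Fin 3) ≃ₗᵢ[ℝ] EuclideanSpace ℝ (Fin 3)) (s : EuclideanSpace ℝ (Fin 3))
    {x : EuclideanSpace ℝ (Fin 3)} (hx : x ∈ (fun p => L p + s) '' fccStacking 1 (Real.sqrt (2 / 3)))
    (v : EuclideanSpace ℝ (Fin 3)) :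
    x + v ∈ (fun p => L p + s) '' fccStacking 1 (Real.sqrt (2 / 3)) ↔ L.symm v ∈ fccStacking 1 (Real.sqrt (2 / 3)) := by
  rw [mem_movedFcc_iff] at hx ⊢
  have e : L.symm (x + v - s) = L.symm (x - s) + L.symm v := by
    rw [← map_add]; congr 1; abel
  rw [e]
  constructor
  · intro h
    have := fcc_sub_site_mem h hx
    rwa [add_sub_cancel_left] at this
  · intro h; exact fcc_add_site_mem hx h

/-- Two points of `L·Λ₀ + s` differ by an `L`-lattice vector. -/
theorem movedFcc_sub_symm_mem (L : EuclideanSpace ℝ (Fin 3) ≃ₗᵢ[ℝ] EuclideanSpace ℝ (Fin 3)) (s : EuclideanSpace ℝ (Fin 3))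
    {x y : EuclideanSpace ℝ (Fin 3)} (hx : x ∈ (fun p => L p + s) '' fccStacking 1 (Real.sqrt (2 / 3)))
    (hy : y ∈ (fun p => L p + s) '' fccStacking 1 (Real.sqrt (2 / 3))) :
    L.symm (x - y) ∈ fccStacking 1 (Real.sqrt (2 / 3)) := by
  have e : x = y + (x - y) := by abel
  rw [e] at hx
  exact (movedFcc_add_mem_iff L s hy (x - y)).1 hx

/-! ### Two arithmetic facts about `Λ₀` -/

/-- **A vector of non-integral squared norm is not a lattice vector** (`8/3` and `11/3` are the cases used). -/
theorem not_mem_fcc_of_norm_sq_eq {v : EuclideanSpace ℝ (Fin 3)} {n : ℤ} (hv : ‖v‖ ^ 2 = (n : ℝ) / 3)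
    (hn : ¬ (3 : ℤ) ∣ n) : v ∉ fccStacking 1 (Real.sqrt (2 / 3)) := by
  intro h
  obtain ⟨m, hm⟩ := exists_int_norm_sq_of_mem_fcc h
  rw [hm] at hv
  have : (3 * m : ℤ) = n := by
    have : ((3 * m : ℤ) : ℝ) = n := by push_cast; linarith
    exact_mod_cast this
  exact hn ⟨m, this.symm⟩

/-- **A unit vector whose double is a lattice vector is a lattice vector** (the lattice vectors of norm `2` are the
doubled slots). -/
theorem mem_fcc_of_two_smul_mem {y : EuclideanSpace ℝ (Fin 3)} (h2 : (2 : ℝ) • y ∈ fccStacking 1 (Real.sqrt (2 / 3)))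
    (hy : ‖y‖ = 1) : y ∈ fccStacking 1 (Real.sqrt (2 / 3)) := by
  obtain ⟨a, b, c, _, ha, hb, hc⟩ := exists_even_cubic_of_mem_fcc h2
  obtain ⟨e0, e1, e2⟩ := sqrt_two_mul_cubicCoords y
  obtain ⟨f0, f1, f2⟩ := sqrt_two_mul_cubicCoords ((2 : ℝ) • y)
  simp only [PiLp.smul_apply, smul_eq_mul] at f0 f1 f2
  -- the doubled coordinates
  have ha' : (a : ℝ) = 2 * (Real.sqrt 2 * cubicCoords y 0) := by rw [← ha, f0, e0]; ring
  have hb' : (b : ℝ) = 2 * (Real.sqrt 2 * cubicCoords y 1) := by rw [← hb, f1, e1]; ring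
  have hc' : (c : ℝ) = 2 * (Real.sqrt 2 * cubicCoords y 2) := by rw [← hc, f2, e2]; ring
  -- `a² + b² + c² = 8`
  have hnorm : ‖y‖ ^ 2 = cubicCoords y 0 ^ 2 + cubicCoords y 1 ^ 2 + cubicCoords y 2 ^ 2 := by
    rw [norm_sq_eq_cubicCoords]; simp [dotProduct, Fin.sum_univ_three, sq]
  have h22 : Real.sqrt 2 ^ 2 = 2 := Real.sq_sqrt (by norm_num)
  have hsum : ((a ^ 2 + b ^ 2 + c ^ 2 : ℤ) : ℝ) = 8 := by
    push_cast
    rw [ha', hb', hc']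
    have : cubicCoords y 0 ^ 2 + cubicCoords y 1 ^ 2 + cubicCoords y 2 ^ 2 = 1 := by rw [← hnorm, hy, one_pow]
    nlinarith [this, h22]
  have hsumZ : a ^ 2 + b ^ 2 + c ^ 2 = 8 := by exact_mod_cast hsum
  have hab : |a| ≤ 2 := by nlinarith [sq_nonneg b, sq_nonneg c, sq_abs a, abs_nonneg a]
  have hbb : |b| ≤ 2 := by nlinarith [sq_nonneg a, sq_nonneg c, sq_abs b, abs_nonneg b]
  have hcb : |c| ≤ 2 := by nlinarith [sq_nonneg a, sq_nonneg b, sq_abs c, abs_nonneg c]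
  rw [abs_le] at hab hbb hcb
  -- the halves are integers with even sum
  have key : a % 2 = 0 ∧ b % 2 = 0 ∧ c % 2 = 0 ∧ (a / 2 + b / 2 + c / 2) % 2 = 0 := by
    obtain ⟨ha1, ha2⟩ := hab
    obtain ⟨hb1, hb2⟩ := hbb
    obtain ⟨hc1, hc2⟩ := hcb
    interval_cases a <;> interval_cases b <;> interval_cases c <;> revert hsumZ <;> norm_num
  obtain ⟨ka, kb, kc, ke⟩ := key
  have ea : a = 2 * (a / 2) := by omega
  have eb : b = 2 * (b / 2) := by omega
  have ec : c = 2 * (c / 2) := by omega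
  have hev : Even (a / 2 + b / 2 + c / 2) := Int.even_iff.2 ke
  refine mem_fcc_of_even_cubic (a / 2) (b / 2) (c / 2) hev ?_ ?_ ?_
  · have h := ha'; rw [ea] at h; push_cast at h; linarith
  · have h := hb'; rw [eb] at h; push_cast at h; linarith
  · have h := hc'; rw [ec] at h; push_cast at h; linarith

/-! ### A frame is determined by one registered face -/

/-- **A face of `G`-slots inside `L·Λ₀` forces `G·slots = L·slots`.** -/
theorem image_fccSlots_eq_of_face_mem (G L : EuclideanSpace ℝ (Fin 3) ≃ₗᵢ[ℝ] EuclideanSpace ℝ (Fin 3))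
    {a b c : EuclideanSpace ℝ (Fin 3)} (ha : a ∈ fccSlots) (hb : b ∈ fccSlots) (hc : c ∈ fccSlots)
    (hab : ⟪a, b⟫_ℝ = 1 / 2) (hac : ⟪a, c⟫_ℝ = 1 / 2) (hbc : ⟪b, c⟫_ℝ = 1 / 2)
    (hGa : L.symm (G a) ∈ fccStacking 1 (Real.sqrt (2 / 3))) (hGb : L.symm (G b) ∈ fccStacking 1 (Real.sqrt (2 / 3)))
    (hGc : L.symm (G c) ∈ fccStacking 1 (Real.sqrt (2 / 3))) :
    (G : EuclideanSpace ℝ (Fin 3) → EuclideanSpace ℝ (Fin 3)) '' ↑fccSlots =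
      (L : EuclideanSpace ℝ (Fin 3) → EuclideanSpace ℝ (Fin 3)) '' ↑fccSlots := by
  have reg : ∀ {w : EuclideanSpace ℝ (Fin 3)}, w ∈ fccSlots → L.symm (G w) ∈ fccStacking 1 (Real.sqrt (2 / 3)) →
      G w ∈ (L : EuclideanSpace ℝ (Fin 3) → EuclideanSpace ℝ (Fin 3)) '' ↑fccSlots := by
    intro w hw hreg
    have h1 : ‖L.symm (G w)‖ = 1 := by
      rw [LinearIsometryEquiv.norm_map, LinearIsometryEquiv.norm_map, norm_eq_one_of_mem_fccSlots hw]
    exact ⟨L.symm (G w), Finset.mem_coe.2 (mem_fccSlots_of_unit hreg h1), by simp⟩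
  exact image_fccSlots_eq_of_triangle G L ha hb hc hab hac hbc (reg ha hGa) (reg hb hGb) (reg hc hGc)

/-! ### FULL readings on a two-lattice configuration -/

section TwoLattice

variable {X : Finset (EuclideanSpace ℝ (Fin 3))}

/-- Ordered auxiliary form of `full_reading_twoLattice`: `q ∈ Λ_a`; either every `G`-slot is an `L_a`-lattice vector or
`q ∈ Λ_b` as well. -/
theorem full_reading_aux (La Lb : EuclideanSpace ℝ (Fin 3) ≃ₗᵢ[ℝ] EuclideanSpace ℝ (Fin 3)) (sa sb : EuclideanSpace ℝ (Fin 3))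
    (hX : ∀ x ∈ X, x ∈ (fun p => La p + sa) '' fccStacking 1 (Real.sqrt (2 / 3)) ∨
      x ∈ (fun p => Lb p + sb) '' fccStacking 1 (Real.sqrt (2 / 3)))
    (G : EuclideanSpace ℝ (Fin 3) ≃ₗᵢ[ℝ] EuclideanSpace ℝ (Fin 3)) {q : EuclideanSpace ℝ (Fin 3)}
    (hq : q ∈ (fun p => La p + sa) '' fccStacking 1 (Real.sqrt (2 / 3)))
    (hfull : ∀ w ∈ fccSlots, q + G w ∈ X) :
    (∀ w ∈ fccSlots, La.symm (G w) ∈ fccStacking 1 (Real.sqrt (2 / 3))) ∨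
      q ∈ (fun p => Lb p + sb) '' fccStacking 1 (Real.sqrt (2 / 3)) := by
  by_cases hqb : q ∈ (fun p => Lb p + sb) '' fccStacking 1 (Real.sqrt (2 / 3))
  · exact Or.inr hqb
  refine Or.inl fun w hw => ?_
  rcases hX _ (hfull w hw) with h | h
  · exact (movedFcc_add_mem_iff La sa hq (G w)).1 h
  -- `q + G w ∈ Λ_b`; look at `q − G w`
  rcases hX _ (hfull (-w) (neg_mem_fccSlots hw)) with h' | h'
  · have := (movedFcc_add_mem_iff La sa hq (G (-w))).1 h'
    rw [map_neg, map_neg] at this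
    simpa using fcc_neg_mem this
  · -- both `q ± G w ∈ Λ_b`: `2 G w` is an `L_b`-lattice vector, hence so is `G w`, hence `q ∈ Λ_b`
    exfalso
    have h2 : Lb.symm (q + G w - (q + G (-w))) ∈ fccStacking 1 (Real.sqrt (2 / 3)) := movedFcc_sub_symm_mem Lb sb h h'
    have e : q + G w - (q + G (-w)) = (2 : ℝ) • G w := by rw [map_neg]; module
    rw [e, LinearIsometryEquiv.map_smul] at h2
    have h1 : Lb.symm (G w) ∈ fccStacking 1 (Real.sqrt (2 / 3)) :=
      mem_fcc_of_two_smul_mem h2 (by rw [LinearIsometryEquiv.norm_map, LinearIsometryEquiv.norm_map,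
        norm_eq_one_of_mem_fccSlots hw])
    apply hqb
    have e' : q = (q + G w) + (-(G w)) := by abel
    rw [e', movedFcc_add_mem_iff Lb sb h]
    rw [map_neg]; exact fcc_neg_mem h1

/-- **Mixed faces are impossible**: if every slot of `G` is an `L_a`- or an `L_b`-lattice vector, then the three slots of
a face are all `L_a`-lattice vectors or all `L_b`-lattice vectors. -/
theorem face_pure_of_cover (La Lb G : EuclideanSpace ℝ (Fin 3) ≃ₗᵢ[ℝ] EuclideanSpace ℝ (Fin 3))
    (hcov : ∀ w ∈ fccSlots, La.symm (G w) ∈ fccStacking 1 (Real.sqrt (2 / 3)) ∨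
      Lb.symm (G w) ∈ fccStacking 1 (Real.sqrt (2 / 3)))
    {a b c : EuclideanSpace ℝ (Fin 3)} (ha : a ∈ fccSlots) (hb : b ∈ fccSlots) (hc : c ∈ fccSlots)
    (hab : ⟪a, b⟫_ℝ = 1 / 2) (hac : ⟪a, c⟫_ℝ = 1 / 2) (hbc : ⟪b, c⟫_ℝ = 1 / 2) :
    (La.symm (G a) ∈ fccStacking 1 (Real.sqrt (2 / 3)) ∧ La.symm (G b) ∈ fccStacking 1 (Real.sqrt (2 / 3)) ∧
        La.symm (G c) ∈ fccStacking 1 (Real.sqrt (2 / 3))) ∨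
      (Lb.symm (G a) ∈ fccStacking 1 (Real.sqrt (2 / 3)) ∧ Lb.symm (G b) ∈ fccStacking 1 (Real.sqrt (2 / 3)) ∧
        Lb.symm (G c) ∈ fccStacking 1 (Real.sqrt (2 / 3))) := by
  -- transfer along an edge: if `x − y` is a slot, membership passes between `x` and `y`
  have edge : ∀ (L L' : EuclideanSpace ℝ (Fin 3) ≃ₗᵢ[ℝ] EuclideanSpace ℝ (Fin 3)) {x y : EuclideanSpace ℝ (Fin 3)},
      x ∈ fccSlots → y ∈ fccSlots → ⟪x, y⟫_ℝ = 1 / 2 →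
      (∀ w ∈ fccSlots, L.symm (G w) ∈ fccStacking 1 (Real.sqrt (2 / 3)) ∨
        L'.symm (G w) ∈ fccStacking 1 (Real.sqrt (2 / 3))) →
      L.symm (G x) ∈ fccStacking 1 (Real.sqrt (2 / 3)) → L.symm (G y) ∉ fccStacking 1 (Real.sqrt (2 / 3)) →
      L'.symm (G x) ∈ fccStacking 1 (Real.sqrt (2 / 3)) := by
    intro L L' x y hx hy hxy hcov' hLx hLy
    have hxy' := sub_mem_fccSlots_of_inner_eq_half hx hy hxy
    rcases hcov' _ hxy' with h | h
    · exfalso; apply hLy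
      have : L.symm (G y) = L.symm (G x) - L.symm (G (x - y)) := by rw [map_sub, map_sub]; abel
      rw [this]; exact fcc_sub_site_mem hLx h
    · rcases hcov' _ hy with h' | h'
      · exact absurd h' hLy
      · have : L'.symm (G x) = L'.symm (G y) + L'.symm (G (x - y)) := by rw [map_sub, map_sub]; abel
        rw [this]; exact fcc_add_site_mem h' h
  have hba : ⟪b, a⟫_ℝ = 1 / 2 := by rw [real_inner_comm]; exact hab
  have hca : ⟪c, a⟫_ℝ = 1 / 2 := by rw [real_inner_comm]; exact hac
  have hcb : ⟪c, b⟫_ℝ = 1 / 2 := by rw [real_inner_comm]; exact hbc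
  by_cases hA : La.symm (G a) ∈ fccStacking 1 (Real.sqrt (2 / 3)) ∧ La.symm (G b) ∈ fccStacking 1 (Real.sqrt (2 / 3)) ∧
      La.symm (G c) ∈ fccStacking 1 (Real.sqrt (2 / 3))
  · exact Or.inl hA
  right
  -- some vertex `y` is not `L_a`-registered; then every vertex is `L_b`-registered
  have hcovs : ∀ w ∈ fccSlots, Lb.symm (G w) ∈ fccStacking 1 (Real.sqrt (2 / 3)) ∨
      La.symm (G w) ∈ fccStacking 1 (Real.sqrt (2 / 3)) := fun w hw => (hcov w hw).symm
  -- helper: a vertex adjacent (inner ½) to a non-`L_a` vertex is `L_b`-registered, and the non-`L_a` vertex itself too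
  have self_b : ∀ {y : EuclideanSpace ℝ (Fin 3)}, y ∈ fccSlots → La.symm (G y) ∉ fccStacking 1 (Real.sqrt (2 / 3)) →
      Lb.symm (G y) ∈ fccStacking 1 (Real.sqrt (2 / 3)) := fun hy hny => (hcov _ hy).resolve_left hny
  have adj_b : ∀ {x y : EuclideanSpace ℝ (Fin 3)}, x ∈ fccSlots → y ∈ fccSlots → ⟪x, y⟫_ℝ = 1 / 2 →
      La.symm (G y) ∉ fccStacking 1 (Real.sqrt (2 / 3)) → Lb.symm (G x) ∈ fccStacking 1 (Real.sqrt (2 / 3)) := by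
    intro x y hx hy hxy hny
    by_cases hLx : La.symm (G x) ∈ fccStacking 1 (Real.sqrt (2 / 3))
    · exact edge La Lb hx hy hxy hcov hLx hny
    · exact self_b hx hLx
  simp only [not_and_or] at hA
  rcases hA with hna | hnb | hnc
  · exact ⟨self_b ha hna, adj_b hb ha hba hna, adj_b hc ha hca hna⟩
  · exact ⟨adj_b ha hb hab hnb, self_b hb hnb, adj_b hc hb hcb hnb⟩
  · exact ⟨adj_b ha hc hac hnc, adj_b hb hc hbc hnc, self_b hc hnc⟩

/-- **FULL readings on `X ⊆ Λ₁ ∪ Λ₂` come from the two plate frames only.** -/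
theorem full_reading_twoLattice (L₁ L₂ : EuclideanSpace ℝ (Fin 3) ≃ₗᵢ[ℝ] EuclideanSpace ℝ (Fin 3))
    (s₁ s₂ : EuclideanSpace ℝ (Fin 3))
    (hX : ∀ x ∈ X, x ∈ (fun p => L₁ p + s₁) '' fccStacking 1 (Real.sqrt (2 / 3)) ∨
      x ∈ (fun p => L₂ p + s₂) '' fccStacking 1 (Real.sqrt (2 / 3)))
    (G : EuclideanSpace ℝ (Fin 3) ≃ₗᵢ[ℝ] EuclideanSpace ℝ (Fin 3)) {q : EuclideanSpace ℝ (Fin 3)} (hq : q ∈ X)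
    (hfull : ∀ w ∈ fccSlots, q + G w ∈ X) :
    (G : EuclideanSpace ℝ (Fin 3) → EuclideanSpace ℝ (Fin 3)) '' ↑fccSlots =
        (L₁ : EuclideanSpace ℝ (Fin 3) → EuclideanSpace ℝ (Fin 3)) '' ↑fccSlots ∨
      (G : EuclideanSpace ℝ (Fin 3) → EuclideanSpace ℝ (Fin 3)) '' ↑fccSlots =
        (L₂ : EuclideanSpace ℝ (Fin 3) → EuclideanSpace ℝ (Fin 3)) '' ↑fccSlots := by
  obtain ⟨a, ha, b, hb, c, hc, hab, hac, hbc⟩ := exists_model_face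
  -- the case `q ∈ Λ₁ ∩ Λ₂`
  have both : q ∈ (fun p => L₁ p + s₁) '' fccStacking 1 (Real.sqrt (2 / 3)) →
      q ∈ (fun p => L₂ p + s₂) '' fccStacking 1 (Real.sqrt (2 / 3)) →
      (G : EuclideanSpace ℝ (Fin 3) → EuclideanSpace ℝ (Fin 3)) '' ↑fccSlots =
          (L₁ : EuclideanSpace ℝ (Fin 3) → EuclideanSpace ℝ (Fin 3)) '' ↑fccSlots ∨
        (G : EuclideanSpace ℝ (Fin 3) → EuclideanSpace ℝ (Fin 3)) '' ↑fccSlots =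
          (L₂ : EuclideanSpace ℝ (Fin 3) → EuclideanSpace ℝ (Fin 3)) '' ↑fccSlots := by
    intro hq₁ hq₂
    have hcov : ∀ w ∈ fccSlots, L₁.symm (G w) ∈ fccStacking 1 (Real.sqrt (2 / 3)) ∨
        L₂.symm (G w) ∈ fccStacking 1 (Real.sqrt (2 / 3)) := by
      intro w hw
      rcases hX _ (hfull w hw) with h | h
      · exact Or.inl ((movedFcc_add_mem_iff L₁ s₁ hq₁ (G w)).1 h)
      · exact Or.inr ((movedFcc_add_mem_iff L₂ s₂ hq₂ (G w)).1 h)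
    rcases face_pure_of_cover L₁ L₂ G hcov ha hb hc hab hac hbc with ⟨h1, h2, h3⟩ | ⟨h1, h2, h3⟩
    · exact Or.inl (image_fccSlots_eq_of_face_mem G L₁ ha hb hc hab hac hbc h1 h2 h3)
    · exact Or.inr (image_fccSlots_eq_of_face_mem G L₂ ha hb hc hab hac hbc h1 h2 h3)
  rcases hX q hq with hq₁ | hq₂
  · rcases full_reading_aux L₁ L₂ s₁ s₂ hX G hq₁ hfull with hreg | hq₂
    · exact Or.inl (image_fccSlots_eq_of_face_mem G L₁ ha hb hc hab hac hbc (hreg a ha) (hreg b hb) (hreg c hc))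
    · exact both hq₁ hq₂
  · have hX' : ∀ x ∈ X, x ∈ (fun p => L₂ p + s₂) '' fccStacking 1 (Real.sqrt (2 / 3)) ∨
        x ∈ (fun p => L₁ p + s₁) '' fccStacking 1 (Real.sqrt (2 / 3)) := fun x hx => (hX x hx).symm
    rcases full_reading_aux L₂ L₁ s₂ s₁ hX' G hq₂ hfull with hreg | hq₁
    · exact Or.inr (image_fccSlots_eq_of_face_mem G L₂ ha hb hc hab hac hbc (hreg a ha) (hreg b hb) (hreg c hc))
    · exact both hq₁ hq₂

end TwoLattice

end Summit.Ventures.Crystal3D.Theorems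

end
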